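import Mathlib
import Summits.MatrixMultiplication.MatrixMultiplication.Theorems.SnSubsetDichotomyPolynomialSlackSplitBCSharp
import Summits.MatrixMultiplication.MatrixMultiplication.Theorems.SnSubsetDichotomyPolynomialSlackSharpExcess
import Summits.MatrixMultiplication.MatrixMultiplication.Theorems.SnSubsetDichotomyPolynomialSlackStructure
import Summits.MatrixMultiplication.MatrixMultiplication.Theorems.SnSubsetDichotomyPolynomialSlackStubSplit
import Literature.Combinatorics.Additive.TPPGroupAlgebra

/-!
# One dense quotient: the SHARP explicit volume bound

Crux `Summit.MatrixMultiplication.MatrixMultiplication.Theses.SnSubsetDichotomy.PolynomialSlack`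
(item `stmt-MatrixMultiplication-8306`), level-one programme, lead c8 (the 5/8 step), line
transport-split-hull. The sharp analogue of `volume_le_of_one_dense` (file `…OneDense`): in the labelling
where `A = S⁻¹T` is dense (`K_A = n!/(|S||T|) < 16M`) and `B = T⁻¹U`, `C = U⁻¹S` are not
(`K_B, K_C ≥ 16M`), a parity-pure TPP triple `S, T, U ⊆ S_n` (`n ≥ 40`) with `F := n!√(n!)/N ≤ 8n`
(`N = |S||T||U|`) and `1 ≤ M ≤ n⁴` satisfies, for every bound `B` on the TPP volumes of `S_{n-1}`,

  `|S||T||U| ≤ 10368·9600²·36000000·(1+log n)¹²·n·B`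

as soon as `F(√6/√(n(n-1)) + 30√(6G²/M)/√(n-1)) + 4Λ²nM²√M/((n-1)F) ≤ 1/(7776Λ²G⁴)`, where
`G = 1 + log n` and `Λ = 1200G²` (`volume_le_of_one_dense_sharp`). Proof: feed `volume_le_of_split_BC_sharp`
with the pair-log parameter `L = 6G` (valid as `K_B, K_C ≤ F² ≤ 64n²`, so `4n·K_X ≤ 256n³ ≤ e⁶n⁶`),
`Λ = 200·G·L = 1200G²`, the F-explicit sharp excess `δ₄ = 4Λ²nM²√M/((n-1)F)` of `sharp_excess_explicit`,
and the level-one error bound `levelOneError_le`; finally `Λ² = 1440000G⁴` and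
`log²(6K_A) ≤ 25G²` (`6 ≤ 6K_A < 96M ≤ 96n⁴ ≤ e⁵n⁴`).
-/

namespace Summit.MatrixMultiplication.MatrixMultiplication.Theorems.PolynomialSlack

open scoped BigOperators
open Literature.Combinatorics.Additive (TripleProductProperty)

-- `Summit.<Summit>.<Problem>` is the tree's mandated summit-side namespace (CONVENTIONS §2); for
-- this single-conjunct summit the two coincide, so each declaration silences `dupNamespace`.
set_option linter.dupNamespace false

/-- `96 ≤ e⁵` (as `e > 2.718` and `2.718⁵ > 148`). [folklore] -/
theorem oneDenseSharp_exp_five : (96 : ℝ) ≤ Real.exp 5 := by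
  have h := Real.exp_one_gt_d9
  have h5 : Real.exp 5 = Real.exp 1 ^ 5 := by rw [← Real.exp_nat_mul]; norm_num
  rw [h5]
  have : (2.7182818283 : ℝ) ^ 5 ≤ Real.exp 1 ^ 5 := pow_le_pow_left₀ (by norm_num) h.le 5
  exact le_trans (by norm_num) this

/-- `256 ≤ e⁶` (as `e > 2.718` and `2.718⁶ > 403`). [folklore] -/
theorem oneDenseSharp_exp_six : (256 : ℝ) ≤ Real.exp 6 := by
  have h := Real.exp_one_gt_d9
  have h6 : Real.exp 6 = Real.exp 1 ^ 6 := by rw [← Real.exp_nat_mul]; norm_num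
  rw [h6]
  have : (2.7182818283 : ℝ) ^ 6 ≤ Real.exp 1 ^ 6 := pow_le_pow_left₀ (by norm_num) h.le 6
  exact le_trans (by norm_num) this

/-- Logarithm bookkeeping: `0 < x ≤ c·n^k` with `0 < c ≤ e^a` gives `log x ≤ a + k log n`. [folklore] -/
theorem oneDenseSharp_log_le {x c a : ℝ} {n : ℕ} (k : ℕ) (hn : (0 : ℝ) < n) (hx : 0 < x) (hc : 0 < c)
    (hxc : x ≤ c * (n : ℝ) ^ k) (hca : c ≤ Real.exp a) : Real.log x ≤ a + k * Real.log n := by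
  calc Real.log x ≤ Real.log (c * (n : ℝ) ^ k) := Real.log_le_log hx hxc
    _ = Real.log c + k * Real.log n := by
        rw [Real.log_mul hc.ne' (pow_ne_zero _ hn.ne'), Real.log_pow]
    _ ≤ a + k * Real.log n := by
        have : Real.log c ≤ a := (Real.log_le_iff_le_exp hc).2 hca
        linarith

set_option maxHeartbeats 1600000 in
/-- **One dense quotient, sharp explicit form** (registered sub-goal `volume_le_of_one_dense_sharp` of
the 5/8 programme). In the labelling where `A = S⁻¹T` is dense (`K_A < 16M`) and `B = T⁻¹U`, `C = U⁻¹S`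
are not (`K_B, K_C ≥ 16M`), a parity-pure TPP triple of non-empty subsets of `S_n` (`n ≥ 40`) with
`1 ≤ M ≤ n⁴`, `F = n!√(n!)/N ≤ 8n` and the smallness condition
`F(√6/√(n(n-1)) + 30√((1+log n)(6(1+log n))/M)/√(n-1)) + 4Λ²nM²√M/((n-1)F) ≤ 1/(7776Λ²(1+log n)⁴)`,
`Λ = 1200(1+log n)²`, satisfies `|S||T||U| ≤ 10368·9600²·36000000·(1+log n)¹²·n·B` for every bound `B`
on the TPP volumes of `S_{n-1}`. [folklore] -/
theorem volume_le_of_one_dense_sharp {n : ℕ} (hn : 40 ≤ n) (B : ℕ)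
    (hB : ∀ S' T' U' : Finset (Equiv.Perm (Fin (n - 1))), TripleProductProperty S' T' U' →
      S'.card * T'.card * U'.card ≤ B)
    {S T U : Finset (Equiv.Perm (Fin n))} (hTPP : TripleProductProperty S T U)
    (hS0 : S.Nonempty) (hT0 : T.Nonempty) (hU0 : U.Nonempty)
    (hS : ∀ s ∈ S, ∀ s' ∈ S, Equiv.Perm.sign s = Equiv.Perm.sign s')
    (hT : ∀ t ∈ T, ∀ t' ∈ T, Equiv.Perm.sign t = Equiv.Perm.sign t')
    (hU : ∀ u ∈ U, ∀ u' ∈ U, Equiv.Perm.sign u = Equiv.Perm.sign u')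
    (M : ℝ) (hM : 1 ≤ M) (hMn : M ≤ (n : ℝ) ^ 4)
    (hKA : (n.factorial : ℝ) / (S.card * T.card : ℕ) < 16 * M)
    (hKB : 16 * M ≤ (n.factorial : ℝ) / (T.card * U.card : ℕ))
    (hKC : 16 * M ≤ (n.factorial : ℝ) / (U.card * S.card : ℕ))
    (hF : (n.factorial : ℝ) * Real.sqrt (n.factorial : ℝ) / (S.card * T.card * U.card : ℕ) ≤ 8 * n)
    (hsmall : (n.factorial : ℝ) * Real.sqrt (n.factorial : ℝ) / (S.card * T.card * U.card : ℕ) *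
          (Real.sqrt 6 / Real.sqrt ((n : ℝ) * ((n : ℝ) - 1)) +
            30 * Real.sqrt ((1 + Real.log n) * (6 * (1 + Real.log n)) / M) / Real.sqrt ((n : ℝ) - 1)) +
        4 * (1200 * (1 + Real.log n) ^ 2) ^ 2 * n * M ^ 2 * Real.sqrt M /
          (((n : ℝ) - 1) *
            ((n.factorial : ℝ) * Real.sqrt (n.factorial : ℝ) / (S.card * T.card * U.card : ℕ))) ≤
        1 / (7776 * (1200 * (1 + Real.log n) ^ 2) ^ 2 * (1 + Real.log n) ^ 4)) :
    ((S.card * T.card * U.card : ℕ) : ℝ) ≤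
      10368 * 9600 ^ 2 * 36000000 * (1 + Real.log n) ^ 12 * n * B := by
  classical
  /- scalars -/
  have hn2 : 2 ≤ n := by omega
  have hnR : (40 : ℝ) ≤ n := by exact_mod_cast hn
  have hn0 : (0 : ℝ) < n := by linarith
  have hm0 : (0 : ℝ) < (n : ℝ) - 1 := by linarith
  have hM0 : 0 < M := by linarith
  have hf0 : (0 : ℝ) < n.factorial := by exact_mod_cast n.factorial_pos
  have hlog0 : 0 ≤ Real.log n := Real.log_nonneg (by linarith)
  -- pair sizes and the volume
  have hα0 : (0 : ℝ) < (S.card * T.card : ℕ) := by exact_mod_cast Nat.mul_pos hS0.card_pos hT0.card_pos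
  have hβ0 : (0 : ℝ) < (T.card * U.card : ℕ) := by exact_mod_cast Nat.mul_pos hT0.card_pos hU0.card_pos
  have hγ0 : (0 : ℝ) < (U.card * S.card : ℕ) := by exact_mod_cast Nat.mul_pos hU0.card_pos hS0.card_pos
  have hN0 : (0 : ℝ) < (S.card * T.card * U.card : ℕ) := by
    exact_mod_cast Nat.mul_pos (Nat.mul_pos hS0.card_pos hT0.card_pos) hU0.card_pos
  have hαle : ((S.card * T.card : ℕ) : ℝ) ≤ n.factorial := by
    exact_mod_cast card_mul_card_le_factorial_of_injOn (injOn_quot_first hTPP hU0)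
  have hprod : ((S.card * T.card : ℕ) : ℝ) * (T.card * U.card : ℕ) * (U.card * S.card : ℕ) =
      ((S.card * T.card * U.card : ℕ) : ℝ) ^ 2 := by
    push_cast; ring
  /- the abbreviations `G, N, F, Λ, δ₄` -/
  set G : ℝ := 1 + Real.log n with hG
  have hG1 : 1 ≤ G := by rw [hG]; linarith
  have hG0 : 0 < G := by linarith
  set N : ℝ := ((S.card * T.card * U.card : ℕ) : ℝ) with hN
  set F : ℝ := (n.factorial : ℝ) * Real.sqrt (n.factorial : ℝ) / N with hFdef
  have hF0 : 0 < F := by rw [hFdef]; positivity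
  set Λ : ℝ := 1200 * G ^ 2 with hΛ
  have hΛ0 : 0 < Λ := by rw [hΛ]; positivity
  set δ₄ : ℝ := 4 * Λ ^ 2 * n * M ^ 2 * Real.sqrt M / (((n : ℝ) - 1) * F) with hδ₄
  have hδ₄0 : 0 ≤ δ₄ := by rw [hδ₄]; positivity
  have hL1 : (1 : ℝ) ≤ 6 * G := by linarith
  have hΛle : 200 * G * (6 * G) ≤ Λ := by rw [hΛ]; exact le_of_eq (by ring)
  /- the co-densities: `K_A K_B K_C = F²`, `1 ≤ K_X ≤ F² ≤ 64 n²` -/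
  have hKKK : (n.factorial : ℝ) / (S.card * T.card : ℕ) * ((n.factorial : ℝ) / (T.card * U.card : ℕ)) *
      ((n.factorial : ℝ) / (U.card * S.card : ℕ)) = F ^ 2 := by
    rw [hFdef, div_pow, mul_pow, Real.sq_sqrt hf0.le, ← hprod]
    field_simp
  have hKA1 : 1 ≤ (n.factorial : ℝ) / (S.card * T.card : ℕ) := by
    rw [le_div_iff₀ hα0]; linarith
  have hKB1 : 1 ≤ (n.factorial : ℝ) / (T.card * U.card : ℕ) := by linarith
  have hKC1 : 1 ≤ (n.factorial : ℝ) / (U.card * S.card : ℕ) := by linarith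
  have hF2 : F ^ 2 ≤ 64 * (n : ℝ) ^ 2 := (pow_le_pow_left₀ hF0.le hF 2).trans_eq (by ring)
  have hKBF : (n.factorial : ℝ) / (T.card * U.card : ℕ) ≤ F ^ 2 := by
    rw [← hKKK]
    have h1 : (1 : ℝ) ≤ (n.factorial : ℝ) / (S.card * T.card : ℕ) * ((n.factorial : ℝ) / (U.card * S.card : ℕ)) :=
      one_le_mul_of_one_le_of_one_le hKA1 hKC1
    have h2 := mul_le_mul_of_nonneg_left h1 (zero_le_one.trans hKB1)
    calc (n.factorial : ℝ) / (T.card * U.card : ℕ) = (n.factorial : ℝ) / (T.card * U.card : ℕ) * 1 :=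
          (mul_one _).symm
      _ ≤ (n.factorial : ℝ) / (T.card * U.card : ℕ) *
          ((n.factorial : ℝ) / (S.card * T.card : ℕ) * ((n.factorial : ℝ) / (U.card * S.card : ℕ))) := h2
      _ = _ := by ring
  have hKCF : (n.factorial : ℝ) / (U.card * S.card : ℕ) ≤ F ^ 2 := by
    rw [← hKKK]
    have h1 : (1 : ℝ) ≤ (n.factorial : ℝ) / (S.card * T.card : ℕ) * ((n.factorial : ℝ) / (T.card * U.card : ℕ)) :=
      one_le_mul_of_one_le_of_one_le hKA1 hKB1
    have h2 := mul_le_mul_of_nonneg_left h1 (zero_le_one.trans hKC1)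
    calc (n.factorial : ℝ) / (U.card * S.card : ℕ) = (n.factorial : ℝ) / (U.card * S.card : ℕ) * 1 :=
          (mul_one _).symm
      _ ≤ (n.factorial : ℝ) / (U.card * S.card : ℕ) *
          ((n.factorial : ℝ) / (S.card * T.card : ℕ) * ((n.factorial : ℝ) / (T.card * U.card : ℕ))) := h2
      _ = _ := by ring
  /- the pair logarithms `≤ L = 6G` -/
  have hlogK : ∀ ζ : ℝ, 0 < ζ → (n.factorial : ℝ) / ζ ≤ F ^ 2 →
      Real.log (4 * n * n.factorial / ζ) ≤ 6 * G := by
    intro ζ hζ hKF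
    have e : 4 * (n : ℝ) * n.factorial / ζ = 4 * n * ((n.factorial : ℝ) / ζ) := by ring
    rw [e]
    have hle : 4 * (n : ℝ) * ((n.factorial : ℝ) / ζ) ≤ 256 * (n : ℝ) ^ 3 :=
      calc 4 * (n : ℝ) * ((n.factorial : ℝ) / ζ) ≤ 4 * n * (64 * (n : ℝ) ^ 2) :=
            mul_le_mul_of_nonneg_left (hKF.trans hF2) (by positivity)
        _ = 256 * (n : ℝ) ^ 3 := by ring
    have h0 : 0 < 4 * (n : ℝ) * ((n.factorial : ℝ) / ζ) := by positivity
    calc Real.log (4 * (n : ℝ) * ((n.factorial : ℝ) / ζ)) ≤ 6 + (3 : ℕ) * Real.log n :=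
          oneDenseSharp_log_le 3 hn0 h0 (by norm_num) hle oneDenseSharp_exp_six
      _ ≤ 6 * G := by rw [hG]; push_cast; linarith
  have hLB : Real.log (4 * n * n.factorial / (T.card * U.card : ℕ)) ≤ 6 * G := hlogK _ hβ0 hKBF
  have hLC : Real.log (4 * n * n.factorial / (U.card * S.card : ℕ)) ≤ 6 * G := hlogK _ hγ0 hKCF
  /- the sharp heavy-mass excess of the sparser quotient -/
  have hsharp := sharp_excess_explicit hn2 Λ M F ((S.card * T.card : ℕ) : ℝ) ((T.card * U.card : ℕ) : ℝ)
    ((U.card * S.card : ℕ) : ℝ) hΛ0 hM hF0 hα0 hβ0 hγ0 hKKK hKA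
  /- the level-one error -/
  have herr : (n.factorial : ℝ) / (2 * N) +
      (n.factorial : ℝ) * Real.sqrt (n.factorial : ℝ) / (2 * N * Real.sqrt (((n * (n - 1) : ℕ) : ℝ) / 6)) +
      3 * Real.sqrt (100 * G * (6 * G) / M) * F / Real.sqrt ((n : ℝ) - 1) ≤
      F * (Real.sqrt 6 / Real.sqrt ((n : ℝ) * ((n : ℝ) - 1)) +
        30 * Real.sqrt (G * (6 * G) / M) / Real.sqrt ((n : ℝ) - 1)) :=
    levelOneError_le hn2 N G (6 * G) M hN0
  have hsm : (n.factorial : ℝ) / (2 * N) +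
      (n.factorial : ℝ) * Real.sqrt (n.factorial : ℝ) / (2 * N * Real.sqrt (((n * (n - 1) : ℕ) : ℝ) / 6)) +
      3 * Real.sqrt (100 * G * (6 * G) / M) * F / Real.sqrt ((n : ℝ) - 1) + δ₄ ≤
      1 / (7776 * Λ ^ 2 * G ^ 4) := by
    linarith [herr, hsmall]
  /- the split bound -/
  have hvol : N ≤ 10368 * 9600 ^ 2 * G ^ 6 * Λ ^ 2 *
      (Real.log (6 * n.factorial / (S.card * T.card : ℕ))) ^ 2 * n * B :=
    volume_le_of_split_BC_sharp hn B hB hTPP hS0 hT0 hU0 hS hT hU M (6 * G) Λ δ₄ hM hL1 hΛle hδ₄0 hKB hKC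
      hLB hLC hsharp hsm
  /- the output conversion: `Λ² = 1440000 G⁴`, `log²(6 K_A) ≤ 25 G²` -/
  have hlogA0 : 0 ≤ Real.log (6 * n.factorial / (S.card * T.card : ℕ)) := by
    apply Real.log_nonneg
    rw [mul_div_assoc]; linarith
  have hlogA : Real.log (6 * n.factorial / (S.card * T.card : ℕ)) ≤ 5 * G := by
    rw [mul_div_assoc]
    have hle : 6 * ((n.factorial : ℝ) / (S.card * T.card : ℕ)) ≤ 96 * (n : ℝ) ^ 4 := by linarith
    have h0 : 0 < 6 * ((n.factorial : ℝ) / (S.card * T.card : ℕ)) := by positivity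
    calc Real.log (6 * ((n.factorial : ℝ) / (S.card * T.card : ℕ))) ≤ 5 + (4 : ℕ) * Real.log n :=
          oneDenseSharp_log_le 4 hn0 h0 (by norm_num) hle oneDenseSharp_exp_five
      _ ≤ 5 * G := by rw [hG]; push_cast; linarith
  have hsq : (Real.log (6 * n.factorial / (S.card * T.card : ℕ))) ^ 2 ≤ 25 * G ^ 2 :=
    (pow_le_pow_left₀ hlogA0 hlogA 2).trans_eq (by ring)
  refine hvol.trans ?_
  have hB0 : (0 : ℝ) ≤ B := Nat.cast_nonneg _
  have hΛ2 : Λ ^ 2 = 1440000 * G ^ 4 := by rw [hΛ]; ring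
  have h0 : (0 : ℝ) ≤ 10368 * 9600 ^ 2 * 1440000 * G ^ 10 * n * B := by positivity
  have h2 := mul_le_mul_of_nonneg_left hsq h0
  calc 10368 * 9600 ^ 2 * G ^ 6 * Λ ^ 2 * (Real.log (6 * n.factorial / (S.card * T.card : ℕ))) ^ 2 * n * B
      = 10368 * 9600 ^ 2 * 1440000 * G ^ 10 * n * B *
          (Real.log (6 * n.factorial / (S.card * T.card : ℕ))) ^ 2 := by rw [hΛ2]; ring
    _ ≤ 10368 * 9600 ^ 2 * 1440000 * G ^ 10 * n * B * (25 * G ^ 2) := h2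
    _ = 10368 * 9600 ^ 2 * 36000000 * G ^ 12 * n * B := by ring

end Summit.MatrixMultiplication.MatrixMultiplication.Theorems.PolynomialSlack
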